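import Literature.NumberTheory.EllipticCurves.FormalGroupQuasiPeriodMulDefectCongruenceProofs
import Literature.NumberTheory.EllipticCurves.FormalGroupEtaHasseInvariantProofs
import Mathlib.RingTheory.LocalRing.ResidueField.Basic
import HarnessLib

/-!
# The η-Hasse congruence over a general coefficient ring and the unit `R_p ≡ −B_p` over a local ring
# (ramified-coefficient inputs for the η-period; proofs only)

`Proofs`-style file (THEOREMS ONLY: no definition, no named fact, no instance), topic `NumberTheory/EllipticCurves`;
sequel of `FormalGroupQuasiPeriodMulDefectCongruenceProofs` (the congruence `R_p ≡ −g_{p−1}·X^p (mod p, X^{p+1})` for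
`W/ℤ`) and `FormalGroupEtaHasseInvariantProofs` (`A_p = 0 ⇒ B_p ≠ 0`). Here the coefficient ring is generalised from `ℤ` to
the rings needed by the RAMIFIED good models of the potentially supersingular Kodaira cells (BSD route EdixhovenFibreFiveSeven,
crux K★ `stmt-BirchSwinnertonDyer-22226`, road item (R1): `W′` over `𝒪_{F′}`, `F′ = ℚ_p(p^{1/e})`):

* §1 over ANY commutative ring `R ↪ A` (`A` a `ℚ`-algebra; `R` a domain of characteristic `0` for the top coefficient) in which `1, …, p−1` are units (`𝒪_{F′}`, `ℤ_(p)`, `W(k)`,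
  any `ℤ_(p)`-algebra), for any integral lift `Rn ∈ R⟦X⟧` of the multiplication defect `R_p(W ⊗ A)` of the quasi-period function:
  **`coeff_mem_span_of_map_eq_formalQuasiPeriodMulDefect`** (`R_j ∈ pR`, `j < p`) and
  **`coeff_prime_add_mem_span_of_map_eq_formalQuasiPeriodMulDefect`** (`R_p + g_{p−1} ∈ pR`). Method: the integral derivative
  identity `Rn' = g_W([p])·[p]' − p·g_W` (tree `derivative_formalQuasiPeriodMulDefect`, chain rule) together with the UNIVERSAL
  decomposition `[p] = p·f + g(X^p)` over every ring (tree `formalMul_prime_eq_add_expand`, AEC IV.4.4), which gives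
  `[p]' = p·(f' + X^{p−1}g'(X^p))` and `g_W([p]) ≡ 0 (mod p, X^p)` (`g_W(0) = 0`), so `Rn' = p·E` with `E ≡ −g_W (mod p, X^p)`.
* §2 over a LOCAL ring `𝒪` with residue field of odd characteristic `p`, `Δ(W) ∈ 𝒪ˣ` and `A_p(W mod 𝔪) = 0` (good supersingular
  reduction): **`isUnit_coeff_formalQuasiPeriodIntegrand_of_hasseCoeff_residue_eq_zero`** — `g_{p−1}(W) = B_p(W) ∈ 𝒪ˣ`
  (`B_p(W mod 𝔪) ≠ 0`, tree `coeff_formalQuasiPeriodIntegrand_ne_zero_of_hasseCoeff_eq_zero`); and for a local DOMAIN with fraction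
  field of characteristic `0`: **`isUnit_coeff_prime_of_map_eq_formalQuasiPeriodMulDefect`** — `R_p ∈ 𝒪ˣ` while `R_j ∈ p𝒪` (`j < p`),
  i.e. `v(R_p(u)) = p·v(u)` for every `u` with `p·v(u) < v(p)`: the η-Hasse transversality input with ramified coefficients.

BSD is not proved by any of this.

## References
* P. Colmez, *Périodes p-adiques des variétés abéliennes*, Math. Ann. 292 (1992), §2. [Colmez1992PeriodesAbeliennes]
* N. M. Katz, *Crystalline cohomology, Dieudonné modules, and Jacobi sums* (1981), §5.1. [Katz1981CrystallineDieudonne]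
* J. H. Silverman, *The Arithmetic of Elliptic Curves*, 2nd ed. (2009), IV.4.4. [SilvermanAEC2009]
-/

noncomputable section

open PowerSeries Literature.NumberTheory.EllipticCurves

namespace WeierstrassCurve

/-! ### §1 The η-Hasse congruence over a general domain -/

section Domain

variable {R A : Type*} [CommRing R] [CommRing A] [Algebra ℚ A] {φ : R →+* A}
  (hφ : Function.Injective φ) (W : WeierstrassCurve R) {p : ℕ} [Fact p.Prime]

omit [Algebra ℚ A] in
/-- `PowerSeries.map` along an injective ring map is injective. [folklore] -/
private theorem powerSeries_map_injective (hφ : Function.Injective φ) :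
    Function.Injective (PowerSeries.map φ) := fun f g h => by
  ext n
  have h' := congrArg (coeff n) h
  rw [coeff_map, coeff_map] at h'
  exact hφ h'

include hφ in
/-- **The integral derivative identity `Rn' = g_W([p]X)·[p]'(X) − p·g_W(X)` in `R⟦X⟧`** for any integral lift `Rn`
of `R_p(W ⊗ A)` along `R ↪ A`. [cite: Katz1981CrystallineDieudonne, §5.1] -/
theorem derivative_eq_of_map_eq_formalQuasiPeriodMulDefect' (n : ℕ) {Rn : R⟦X⟧}
    (hRn : PowerSeries.map φ Rn = (W.map φ).formalQuasiPeriodMulDefect n) :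
    d⁄dX R Rn = W.formalQuasiPeriodIntegrand.subst (W.formalMul n) * d⁄dX R (W.formalMul n) -
      (n : R⟦X⟧) * W.formalQuasiPeriodIntegrand := by
  have hs : HasSubst (W.formalMul n) := HasSubst.of_constantCoeff_zero' (W.constantCoeff_formalMul n)
  apply powerSeries_map_injective hφ
  rw [← derivative_map, hRn, derivative_formalQuasiPeriodMulDefect, map_sub, map_mul,
    WeierstrassCurve.powerSeries_map_subst _ hs, map_formalQuasiPeriodIntegrand, ← derivative_map, map_formalMul,
    map_mul, map_natCast, map_formalQuasiPeriodIntegrand]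

include hφ in
/-- `R_p(0) = 0` for an integral lift. [cite: Katz1981CrystallineDieudonne, §5.1] -/
theorem constantCoeff_eq_zero_of_map_eq_formalQuasiPeriodMulDefect' (n : ℕ) {Rn : R⟦X⟧}
    (hRn : PowerSeries.map φ Rn = (W.map φ).formalQuasiPeriodMulDefect n) : constantCoeff Rn = 0 := by
  have h := congrArg constantCoeff hRn
  rw [← coeff_zero_eq_constantCoeff_apply, coeff_map, coeff_zero_eq_constantCoeff_apply,
    constantCoeff_formalQuasiPeriodMulDefect] at h
  exact hφ (h.trans (map_zero φ).symm)

/-- **`[p]' = p·D`** with `D = f' + X^{p−1}·g'(X^p)` from `[p] = p·f + g(X^p)` over any ring (AEC IV.4.4).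
[cite: SilvermanAEC2009, IV.4.4] -/
theorem derivative_formalMul_prime_eq_natCast_mul :
    d⁄dX R (W.formalMul p) = (p : R⟦X⟧) * (d⁄dX R (W.formalMulPPart p) +
      X ^ (p - 1) * PowerSeries.expand p (Fact.out : p.Prime).ne_zero (d⁄dX R (W.formalMulFrobPart p))) := by
  have hp : p.Prime := Fact.out
  have hd : d⁄dX R ((p : R⟦X⟧) * W.formalMulPPart p) = (p : R⟦X⟧) * d⁄dX R (W.formalMulPPart p) := by
    rw [← nsmul_eq_mul, ← nsmul_eq_mul, map_nsmul]
  rw [W.formalMul_prime_eq_add_expand p, map_add, hd, derivative_expand p hp.ne_zero]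
  ring

/-- **`g_W([p]X) ≡ 0 (mod p, X^p)`** over any ring: `[Xⁱ] g_W([p]X) ∈ pR` for `i < p` (`g_W(0) = 0`, `[p] ≡ g(X^p) (mod p)`).
[cite: Katz1981CrystallineDieudonne, §5.1] -/
theorem coeff_formalQuasiPeriodIntegrand_subst_formalMul_mem_span {i : ℕ} (hi : i < p) :
    coeff i (W.formalQuasiPeriodIntegrand.subst (W.formalMul p)) ∈ Ideal.span {(p : R)} := by
  have hp : p.Prime := Fact.out
  set π := Ideal.Quotient.mk (Ideal.span {(p : R)}) with hπ
  have hs : HasSubst (W.formalMul p) := HasSubst.of_constantCoeff_zero' (W.constantCoeff_formalMul p)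
  rw [← Ideal.Quotient.eq_zero_iff_mem, ← hπ, ← coeff_map, WeierstrassCurve.powerSeries_map_subst _ hs]
  apply coeff_of_lt_order
  have hpπ : (p : (R ⧸ Ideal.span {(p : R)})⟦X⟧) = 0 := by
    rw [← map_natCast (C (R := R ⧸ Ideal.span {(p : R)})) p, ← map_natCast π p, hπ,
      Ideal.Quotient.eq_zero_iff_mem.mpr (Ideal.mem_span_singleton_self _), map_zero]
  have hmap : (W.formalMul p).map π = PowerSeries.expand p hp.ne_zero ((W.formalMulFrobPart p).map π) := by
    rw [map_formalMul, (W.map π).formalMul_prime_eq_add_expand p, hpπ, zero_mul, zero_add, map_formalMulFrobPart]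
  have h0 : constantCoeff ((W.formalMul p).map π) = 0 := by
    rw [← coeff_zero_eq_constantCoeff_apply, coeff_map, coeff_zero_eq_constantCoeff_apply, constantCoeff_formalMul,
      map_zero]
  have hg0 : constantCoeff (W.formalQuasiPeriodIntegrand.map π) = 0 := by
    rw [← coeff_zero_eq_constantCoeff_apply, coeff_map, coeff_zero_eq_constantCoeff_apply,
      constantCoeff_formalQuasiPeriodIntegrand, map_zero]
  have hord : (p : ℕ∞) ≤ ((W.formalMul p).map π).order := by
    refine nat_le_order _ p fun j hj => ?_
    rw [hmap, PowerSeries.coeff_expand]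
    split_ifs with hdvd
    · rcases Nat.eq_zero_or_pos j with rfl | hj0
      · rw [Nat.zero_div, coeff_map, coeff_zero_eq_constantCoeff, constantCoeff_formalMulFrobPart, map_zero]
      · exact absurd (Nat.le_of_dvd hj0 hdvd) (not_le.mpr hj)
    · rfl
  calc (i : ℕ∞) < p := by exact_mod_cast hi
    _ ≤ ((W.formalMul p).map π).order := hord
    _ ≤ _ := le_order_subst_right' h0 hg0

include hφ in
/-- **The η-Hasse congruence over a domain, low part: `R_j ∈ pR` for `j < p`**, provided `1, …, p − 1` are units of `R`
(any integral lift `Rn` of `R_p(W ⊗ A)`): `Rn' = p·E` and `[X⁰]Rn = 0`. [cite: Colmez1992PeriodesAbeliennes, §2]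
[cite: Katz1981CrystallineDieudonne, §5.1] -/
theorem coeff_mem_span_of_map_eq_formalQuasiPeriodMulDefect (hunit : ∀ n : ℕ, 0 < n → n < p → IsUnit (n : R))
    {Rn : R⟦X⟧} (hRn : PowerSeries.map φ Rn = (W.map φ).formalQuasiPeriodMulDefect p) {j : ℕ} (hj : j < p) :
    coeff j Rn ∈ Ideal.span {(p : R)} := by
  rcases Nat.eq_zero_or_pos j with rfl | hj0
  · rw [coeff_zero_eq_constantCoeff, W.constantCoeff_eq_zero_of_map_eq_formalQuasiPeriodMulDefect' hφ p hRn]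
    exact zero_mem _
  obtain ⟨i, rfl⟩ := Nat.exists_eq_add_one_of_ne_zero hj0.ne'
  have h := congrArg (coeff i) (W.derivative_eq_of_map_eq_formalQuasiPeriodMulDefect' hφ p hRn)
  rw [coeff_derivative, W.derivative_formalMul_prime_eq_natCast_mul, mul_left_comm, ← mul_sub,
    ← map_natCast (C (R := R)) p, coeff_C_mul] at h
  -- `(i+1)·R_{i+1} = p·e`
  obtain ⟨u, hu⟩ := hunit (i + 1) (Nat.succ_pos i) hj
  have hcast : ((i : R) + 1) = ((i + 1 : ℕ) : R) := by push_cast; ring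
  rw [hcast, ← hu] at h
  have hmem : coeff (i + 1) Rn * ↑u ∈ Ideal.span {(p : R)} := by
    rw [h]
    exact Ideal.mul_mem_right _ _ (Ideal.mem_span_singleton_self _)
  exact (Ideal.mul_unit_mem_iff_mem _ u.isUnit).mp hmem

include hφ in
/-- **The η-Hasse congruence over a domain, top coefficient: `R_p + g_{p−1} ∈ pR`**, i.e.
`R_p ≡ −g_{p−1}·X^p (mod p, X^{p+1})` with `g_{p−1} = [z^{p+1}](X·ω)` the η-Hasse invariant `B_p(W)` (any integral lift `Rn` of
`R_p(W ⊗ A)`; `R` a domain of characteristic `0`). [cite: Colmez1992PeriodesAbeliennes, §2] [cite: Katz1981CrystallineDieudonne, §5.1] -/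
theorem coeff_prime_add_mem_span_of_map_eq_formalQuasiPeriodMulDefect [IsDomain R] [CharZero R]
    {Rn : R⟦X⟧} (hRn : PowerSeries.map φ Rn = (W.map φ).formalQuasiPeriodMulDefect p) :
    coeff p Rn + coeff (p - 1) W.formalQuasiPeriodIntegrand ∈ Ideal.span {(p : R)} := by
  have hp : p.Prime := Fact.out
  obtain ⟨m, hm⟩ : ∃ m, p = m + 1 := ⟨p - 1, (Nat.succ_pred_eq_of_pos hp.pos).symm⟩
  have hpm : coeff p Rn = coeff (m + 1) Rn := by rw [hm]
  have hm1 : p - 1 = m := by omega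
  rw [hpm, hm1]
  set D := d⁄dX R (W.formalMulPPart p) +
    X ^ (p - 1) * PowerSeries.expand p hp.ne_zero (d⁄dX R (W.formalMulFrobPart p)) with hD
  have h := congrArg (coeff m) (W.derivative_eq_of_map_eq_formalQuasiPeriodMulDefect' hφ p hRn)
  rw [coeff_derivative, W.derivative_formalMul_prime_eq_natCast_mul, ← hD, mul_left_comm,
    ← map_natCast (C (R := R)) p, map_sub, coeff_C_mul, coeff_C_mul,
    show ((m : R) + 1) = (p : R) by rw [hm]; push_cast; ring] at h
  -- `[X^{p-1}](g_W([p]) · D) ∈ pR`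
  have hdvd : coeff m (W.formalQuasiPeriodIntegrand.subst (W.formalMul p) * D) ∈ Ideal.span {(p : R)} := by
    rw [coeff_mul]
    refine Ideal.sum_mem _ fun x hx => Ideal.mul_mem_right _ _
      (W.coeff_formalQuasiPeriodIntegrand_subst_formalMul_mem_span ?_)
    have := Finset.HasAntidiagonal.mem_antidiagonal.1 hx
    omega
  obtain ⟨c, hc⟩ := Ideal.mem_span_singleton'.mp hdvd
  rw [← hc] at h
  have hpz : (p : R) ≠ 0 := Nat.cast_ne_zero.mpr hp.ne_zero
  have key : coeff (m + 1) Rn = c * (p : R) - coeff m W.formalQuasiPeriodIntegrand := by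
    apply mul_left_cancel₀ hpz
    linear_combination h
  rw [key, sub_add_cancel]
  exact Ideal.mul_mem_left _ _ (Ideal.mem_span_singleton_self _)

end Domain

/-! ### §2 Over a local ring: `B_p ∈ 𝒪ˣ` at supersingular reduction, hence `R_p ∈ 𝒪ˣ` -/

section Local

variable {O : Type*} [CommRing O] [IsLocalRing O] (W : WeierstrassCurve O) {p : ℕ} [Fact p.Prime]
  [CharP (IsLocalRing.ResidueField O) p]

/-- **`g_{p−1}(W) = B_p(W) ∈ 𝒪ˣ`** for a Weierstrass equation over a local ring `𝒪` with residue field of odd characteristic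
`p`, `Δ(W) ∈ 𝒪ˣ` and `A_p(W mod 𝔪) = 0` (good supersingular reduction): `B_p(W mod 𝔪) ≠ 0` in the residue field.
[cite: Katz1981CrystallineDieudonne, §5.1] -/
theorem isUnit_coeff_formalQuasiPeriodIntegrand_of_hasseCoeff_residue_eq_zero (hp2 : p ≠ 2) (hΔ : IsUnit W.Δ)
    (hA : (W.map (IsLocalRing.residue O)).hasseCoeff p = 0) :
    IsUnit (coeff (p - 1) W.formalQuasiPeriodIntegrand) := by
  have hΔ' : (W.map (IsLocalRing.residue O)).Δ ≠ 0 := by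
    rw [map_Δ]
    exact (hΔ.map _).ne_zero
  have h := coeff_formalQuasiPeriodIntegrand_ne_zero_of_hasseCoeff_eq_zero hp2 (W.map (IsLocalRing.residue O)) hΔ' hA
  rw [← W.map_formalQuasiPeriodIntegrand, coeff_map, Ne, IsLocalRing.residue_eq_zero_iff] at h
  exact (IsLocalRing.notMem_maximalIdeal).mp h

omit [Fact p.Prime] in
/-- In a local ring with residue characteristic `p`, the naturals `1, …, p − 1` are units. [folklore] -/
private theorem isUnit_natCast_of_lt (n : ℕ) (hn0 : 0 < n) (hnp : n < p) : IsUnit (n : O) := by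
  rw [← IsLocalRing.notMem_maximalIdeal, ← IsLocalRing.residue_eq_zero_iff, map_natCast,
    CharP.cast_eq_zero_iff (IsLocalRing.ResidueField O) p]
  exact fun h => absurd (Nat.le_of_dvd hn0 h) (not_le.mpr hnp)

variable [IsDomain O] [CharZero O] {A : Type*} [CommRing A] [Algebra ℚ A] {φ : O →+* A}
  (hφ : Function.Injective φ)

include hφ in
/-- **`R_p ∈ 𝒪ˣ` and `R_j ∈ p𝒪` (`j < p`)** for the multiplication defect of a Weierstrass equation over a local domain `𝒪` of
characteristic `0` with residue characteristic `p` odd, `Δ ∈ 𝒪ˣ`, `A_p(W mod 𝔪) = 0` (any integral lift `Rn` of `R_p(W ⊗ A)` along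
`𝒪 ↪ A ⊇ ℚ`): `R_p ≡ −B_p (mod p)` and `B_p ∈ 𝒪ˣ`. Consequently `v(R_p(u)) = p·v(u)` whenever `p·v(u) < v(p)` — the η-Hasse
transversality input for models with ramified coefficients. [cite: Colmez1992PeriodesAbeliennes, §2] -/
theorem isUnit_coeff_prime_of_map_eq_formalQuasiPeriodMulDefect (hp2 : p ≠ 2) (hΔ : IsUnit W.Δ)
    (hA : (W.map (IsLocalRing.residue O)).hasseCoeff p = 0) {Rn : O⟦X⟧}
    (hRn : PowerSeries.map φ Rn = (W.map φ).formalQuasiPeriodMulDefect p) :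
    IsUnit (coeff p Rn) ∧ ∀ j < p, coeff j Rn ∈ Ideal.span {(p : O)} := by
  refine ⟨?_, fun j hj => W.coeff_mem_span_of_map_eq_formalQuasiPeriodMulDefect hφ (isUnit_natCast_of_lt (O := O)) hRn hj⟩
  have hsum := W.coeff_prime_add_mem_span_of_map_eq_formalQuasiPeriodMulDefect hφ hRn
  have hB := W.isUnit_coeff_formalQuasiPeriodIntegrand_of_hasseCoeff_residue_eq_zero hp2 hΔ hA
  -- `pO ⊆ 𝔪`, so `R_p ≡ −B_p (mod 𝔪)` is a unit
  have hpm : (p : O) ∈ IsLocalRing.maximalIdeal O := by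
    rw [← IsLocalRing.residue_eq_zero_iff, map_natCast, CharP.cast_eq_zero]
  have hmem : coeff p Rn + coeff (p - 1) W.formalQuasiPeriodIntegrand ∈ IsLocalRing.maximalIdeal O :=
    (Ideal.span_le.mpr (Set.singleton_subset_iff.mpr hpm)) hsum
  rw [← IsLocalRing.notMem_maximalIdeal] at hB ⊢
  intro hR
  exact hB (by simpa using (IsLocalRing.maximalIdeal O).sub_mem hmem hR)

end Local

end WeierstrassCurve

end
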